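import Literature.Computability.Complexity.CodeFPListKit
import Literature.Computability.Complexity.CodeFPBudgets
import Literature.Computability.Complexity.CodeFPLists
import Literature.Computability.Complexity.CodeFPStrings
import Literature.Computability.Complexity.CookBridges
import Summits.PneNP.PneNP.Theorems.SignDeg2AvoidAffineSplitFP
import Summits.PneNP.PneNP.Theorems.PstarLinearisation

/-!
# Linearisation: pure `P⋆` range avoidance is in FP when the AND pairs are few (rung R20-lin) — polynomial time, the rung

FRONTIER range-avoidance ladder, cell `pnp-ideate`, ROUND-20 (planner seat p3's seed §5, item R20-lin; restricted-model
algorithmics — nothing here bears on `P` versus `NP`).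

The linearisation machine `linStr` of `PstarLinearisation` (decode; rows `e_a + e_b + e_{n + first output with the same
AND pair}`; first dependent row by the span test; print its indicator) is typed in the tree's `CodeFP` algebra — the
decoder `LocalMapDecodeFP.codeFP_decode`, a `min/max` on two list entries, a `findIdx` over an equality test of pair
codes, `AffineSplitFP.codeFP_tStar` (the `findIdx` over `Nc03Reduction.codeFP_inSpan`), and a `map` over `List.range` —
hence `IsPolyTime linStr` (`isPolyTime_linStr`, via `CookBridges.isPolyTime_iff`).  With `linStr_correct` this proves

  `pstarLinearisable_localAvoidLinearFP : LocalAvoidLinearFP 4 LinearisablePstar`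
  (`LinearisablePstar I := I.IsPure xorAndPred ∧ n + numAndPairs I < m`; stretch constant `0` — the class carries it),

and the planner's formulation `pstarFewAndPairs_localAvoidLinearFP` («`#distinct AND pairs ≤ m − n − 2`», stretch `2`).
This is the cheap positive rung R20-lin of ROUND-20: the linearisation certificate (no-go N1 of ROUND-19 on the wall,
where `#pairs ≈ m`) solves exactly the AND-pair-poor instances; the wall `m = C·n` with `m` distinct pairs is untouched.
-/

set_option linter.dupNamespace false -- `Summit.PneNP.PneNP.…`: summit = sub-problem name (D-0017 single-conjunct layout)

namespace Summit.PneNP.PneNP.Theorems.PstarLinearisation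

open Literature.Computability.Complexity
open Summit.PneNP.PneNP.Theorems.LocalMapDecodeFP (decode hdrN outE codeFP_decode codeFP_hdrN)
open Summit.PneNP.PneNP.Theorems.AffineSplitFP (tStar codeFP_tStar)

/-! ## The class and the rung (statements) -/

/-- The LINEARISABLE class of pure `P⋆` instances: more outputs than monomials, `m > n + #{distinct AND pairs}`
(contains the planner's sub-class «`#pairs ≤ m − n − 2`» of ROUND-20 §5). -/
def LinearisablePstar ⦃n m : ℕ⦄ (I : LocalMap 4 n m) : Prop := I.IsPure xorAndPred ∧ n + numAndPairs I < m

/-- **Rung R20-lin** (statement): range avoidance in FP for the linearisable pure `P⋆` maps (proved below,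
`pstarLinearisable_localAvoidLinearFP`). -/
def PstarLinearisableAvoidLinearFP : Prop := LocalAvoidLinearFP 4 LinearisablePstar

/-! ## Typing in the `CodeFP` algebra -/

section PolyTime

open CodeFP

/-- Code of an AND-pair key. -/
abbrev keyE : ℕ × ℕ → List Bool := pairE natE natE

/-- `min` as a branch on the comparison bit. -/
theorem min_eq_ite (a b : ℕ) : min a b = (if decide (a ≤ b) then a else b) := by
  rw [Nat.min_def]
  by_cases h : a ≤ b <;> simp [h]

/-- `max` as a branch on the comparison bit. -/
theorem max_eq_ite (a b : ℕ) : max a b = (if decide (a ≤ b) then b else a) := by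
  rw [Nat.max_def]
  by_cases h : a ≤ b <;> simp [h]

/-- The AND-pair key of a position list is polynomial time. -/
theorem codeFP_pairKey : CodeFP (rawE natE) keyE pairKey := by
  have h2 : CodeFP (rawE natE) natE (fun pos => pos.getD 2 0) :=
    ((rawGetD natE (d := 0) natE_zero).comp ((CodeFP.id _).pair (const _ (2 : ℕ)))).congr fun _ => rfl
  have h3 : CodeFP (rawE natE) natE (fun pos => pos.getD 3 0) :=
    ((rawGetD natE (d := 0) natE_zero).comp ((CodeFP.id _).pair (const _ (3 : ℕ)))).congr fun _ => rfl
  have hle : CodeFP (rawE natE) bitE (fun pos => decide (pos.getD 2 0 ≤ pos.getD 3 0)) :=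
    (natLe.comp (h2.pair h3)).congr fun _ => rfl
  have hmin : CodeFP (rawE natE) natE (fun pos => min (pos.getD 2 0) (pos.getD 3 0)) :=
    (hle.ite h2 h3).congr fun pos => (min_eq_ite _ _).symm
  have hmax : CodeFP (rawE natE) natE (fun pos => max (pos.getD 2 0) (pos.getD 3 0)) :=
    (hle.ite h3 h2).congr fun pos => (max_eq_ite _ _).symm
  exact (hmin.pair hmax).congr fun _ => rfl

/-- The keys of all decoded outputs are polynomial time. -/
theorem codeFP_keysOf : CodeFP (rawE outE) (rawE keyE) keysOf :=
  (map₀ (codeFP_pairKey.comp (snd strE (rawE natE)))).congr fun _ => rfl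

/-- One row is polynomial time (in the context: ambient `N` in unary and the key list). -/
theorem codeFP_linRowD :
    CodeFP (pairE (pairE unE (rawE keyE)) outE) (rawE natE) (fun t => linRowD t.1.1 t.1.2 t.2) := by
  have hpos : CodeFP (pairE (pairE unE (rawE keyE)) outE) (rawE natE) (fun t => t.2.2) := (snd _ _).snd'
  have ha : CodeFP (pairE (pairE unE (rawE keyE)) outE) natE (fun t => t.2.2.getD 0 0) :=
    ((rawGetD natE (d := 0) natE_zero).comp (hpos.pair (const _ (0 : ℕ)))).congr fun _ => rfl
  have hb : CodeFP (pairE (pairE unE (rawE keyE)) outE) natE (fun t => t.2.2.getD 1 0) :=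
    ((rawGetD natE (d := 0) natE_zero).comp (hpos.pair (const _ (1 : ℕ)))).congr fun _ => rfl
  have hkey : CodeFP (pairE (pairE unE (rawE keyE)) outE) keyE (fun t => pairKey t.2.2) := codeFP_pairKey.comp hpos
  have hkeys : CodeFP (pairE (pairE unE (rawE keyE)) outE) (rawE keyE) (fun t => t.1.2) := (fst _ _).snd'
  have htest : CodeFP (pairE keyE keyE) bitE (fun q => decide (q.2 = q.1)) :=
    (CodeFP.eq (pairE_injective natE_injective natE_injective)).comp ((snd keyE keyE).pair (fst keyE keyE))
  have hidx : CodeFP (pairE (pairE unE (rawE keyE)) outE) natE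
      (fun t => t.1.2.findIdx fun κ => decide (κ = pairKey t.2.2)) :=
    ((findIdxFP (σ := ℕ × ℕ) (eσ := keyE) (eα := keyE) (p := fun q => decide (q.2 = q.1)) htest).comp
      (hkey.pair hkeys)).congr fun _ => rfl
  have hN : CodeFP (pairE (pairE unE (rawE keyE)) outE) natE (fun t => t.1.1) :=
    (natOfUn.comp (fst _ _).fst').congr fun _ => rfl
  have hthird : CodeFP (pairE (pairE unE (rawE keyE)) outE) natE
      (fun t => t.1.1 + t.1.2.findIdx fun κ => decide (κ = pairKey t.2.2)) :=
    (natAdd.comp (hN.pair hidx)).congr fun _ => rfl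
  exact ((rawCons natE).comp (ha.pair ((rawCons natE).comp (hb.pair ((rawSingleton natE).comp hthird))))).congr
    fun _ => rfl

/-- All rows are polynomial time. -/
theorem codeFP_rowsD : CodeFP (pairE unE (rawE outE)) (rawE (rawE natE)) (fun p => rowsD p.1 p.2) := by
  have hkeys : CodeFP (pairE unE (rawE outE)) (rawE keyE) (fun p => keysOf p.2) := codeFP_keysOf.comp (snd _ _)
  exact ((map codeFP_linRowD).comp (((fst _ _).pair hkeys).pair (snd _ _))).congr fun _ => rfl

/-- **Finding the first dependent output is polynomial time** (`AffineSplitFP.codeFP_tStar`). -/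
theorem codeFP_jLin : CodeFP (pairE unE (rawE outE)) natE (fun p => jLin p.1 p.2) := by
  have hdim : CodeFP (pairE unE (rawE outE)) unE (fun p => p.1 + p.2.length) :=
    unAdd.comp ((fst _ _).pair ((ulength outE).comp (snd _ _)))
  exact (codeFP_tStar.comp (hdim.pair codeFP_rowsD)).congr fun _ => rfl

/-- The answer on decoded data is polynomial time. -/
theorem codeFP_outLin : CodeFP (pairE unE (rawE outE)) (rawE bitE) (fun p => outLin p.1 p.2) := by
  have hrange : CodeFP (pairE unE (rawE outE)) (rawE natE) (fun p => List.range p.2.length) :=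
    (urange.comp ((ulength outE).comp (snd unE (rawE outE)))).congr fun _ => rfl
  have hg : CodeFP (pairE natE natE) bitE (fun t => t.2 == t.1) :=
    (beq natE_injective).comp ((snd natE natE).pair (fst natE natE))
  exact ((map hg).comp (codeFP_jLin.pair hrange)).congr fun _ => rfl

/-- **The linearisation machine is computed on codes in polynomial time.** -/
theorem codeFP_linStr : CodeFP strE strE linStr :=
  (bitsToStr.comp (codeFP_outLin.comp (codeFP_hdrN.pair (codeFP_decode 4)))).congr fun _ => rfl

/-- **`linStr` is polynomial-time computable** (`IsPolyTime`). -/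
theorem isPolyTime_linStr : IsPolyTime linStr := by
  obtain ⟨f, hf, hfw⟩ := codeFP_linStr
  have h : f = linStr := funext fun w => hfw w
  rw [h] at hf
  exact (CookBridges.isPolyTime_iff _).2 hf

end PolyTime

/-! ## The rung -/

/-- **RUNG R20-lin — linearisation**: range avoidance is in FP, by the ONE polynomial-time function `linStr` and at
every stretch (constant `0`: the class itself forces `m > n`), for the pure `P⋆` maps with `m > n + #{distinct AND pairs}`
— the `m` output parities `x_a ⊕ x_b ⊕ x_c x_d` are then linearly dependent over `𝔽₂` as polynomials, Gaussian
elimination finds the first dependent output `j⋆`, and `e_{j⋆}` is outside the range.  Restricted-model algorithmic rung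
of the range-avoidance ladder (cell pnp-ideate, ROUND-20); it says nothing about `P` versus `NP`. -/
theorem pstarLinearisable_localAvoidLinearFP : PstarLinearisableAvoidLinearFP :=
  ⟨0, linStr, isPolyTime_linStr, fun _ _ I hI _ _ => linStr_correct I hI.1 hI.2⟩

/-- **The planner's formulation** (ROUND-20-SEED §5, verbatim class «pure `P⋆` ∧ `#distinct AND pairs ≤ m − n − 2`»):
in FP at stretch `m ≥ 2n` by the same function (for `n ≥ 1`, `m ≥ 2n` the side condition gives `n + #pairs < m`). -/
theorem pstarFewAndPairs_localAvoidLinearFP :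
    LocalAvoidLinearFP 4 (fun n m I => I.IsPure xorAndPred ∧ numAndPairs I ≤ m - n - 2) :=
  ⟨2, linStr, isPolyTime_linStr, fun n m I hI hn hm => linStr_correct I hI.1 (by have h := hI.2; omega)⟩

end Summit.PneNP.PneNP.Theorems.PstarLinearisation
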